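import Summits.Ventures.HodgeRepro.Tier3WedgeRestrictScalars

/-!
# The Weil line is `∧^n_K V` — Deligne's direct summand on the abstract data (LEMMA-R-RESIDUE.md §4(b))

Blind re-derivation cell `pub-hodge-repro`, seat `t3-p4` (Tier 3, T3.5 for T3.4 = Lemma R).  Target tree path
`lean/Summits/Ventures/HodgeRepro/Tier3WeilLineRestriction.lean`; imports Mathlib and the cell's
`Tier3WedgeRestrictScalars` (hence `Tier3LemmaRWeilLine`, `Tier3WeilProjector`, `Tier3WedgeBaseChange` and everything
below them).

WHAT THIS FILE STATES.  The paper DEFINES the Weil line as `W_F(B) := ∧^{2p}_F H¹(B, ℚ)` and embeds it in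
`H^{2p}(B, ℚ) = ∧^{2p}_ℚ H¹(B, ℚ)` by Deligne's Lemma 4.3(b) («`∧ⁿ_{k′} V` is, in a natural way, a direct summand of
`∧ⁿ_k V`», LNM 900 p0029:L28–L34, proof L55–L70) with `W_F(B) ⊗ ℂ = ⊕_σ ⊗_i ℓ^{(i)}_σ` (Prop. 4.4's proof, p0030:L63–L76;
Milne 2020 §2.2's diagram).  Every kernel twin of the lane (`Tier3WeilProjector`, `Tier3LemmaRWeilLine`,
`Tier3LemmaRGenerator`, `Tier3LemmaRCorrespondence`) characterises `W_F` only through its base change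
(`W_F ⊗ K = span {E′_L : L a σ-line}`).  `weil_line_restrictScalars` identifies the two, for `K/F₀` finite Galois and a
`K`-space `V` with `K`-basis `ω′ : ι → V`, `n = |ι|`: with `q : ⋀[F₀]^n V → ⋀[K]^n V` the restriction-of-scalars map
of `Tier3WedgeRestrictScalars`, (1) `1 ⊗ q` kills every wedge `E′_L` off the lines; (2) on the `σ`-line wedge it
produces a `σ`-eigenvector; (3) the images of the line wedges form a `K`-basis of `K ⊗ ⋀[K]^n V` — «`W_F(B) ⊗ ℂ =
⊕_σ ⊗_i ℓ^{(i)}_σ`» read through `q`; (4) `q` is injective on `W_F`; (5) `q` maps `W_F` ONTO `⋀[K]^n V`; (6)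
`⋀[F₀]^n V = W_F ⊕ ker q` (`IsCompl W_F (ker q)`) — Deligne's direct summand, with the summand identified as the
Weil line of the kernel twins.  `exists_weil_line_section`: the section `s` of `q` with image `W_F` («in a natural
way, a direct summand»).  `exists_weil_line_restrictScalars`: everything assembled from `ω′` alone as one existential
(eigenbasis, base change, wedge basis, `W_F` with its projector and `dim_{F₀} W_F = [K : F₀]`, `q`, the section).
Read with `V = H¹(B, ℚ)`, `K = F`, `F₀ = ℚ`, `n = 2p`: the `W_F` of `Tier3LemmaRGenerator.exists_weil_line_generator`
IS `∧^{2p}_F H¹(B, ℚ)` embedded by Deligne's lemma.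

HONESTY.  Linear algebra on the cell's own modules; no definition is introduced; nothing geometric is built.
HC_CM is NOT proved by anyone in this repository.
-/

set_option autoImplicit false

open TensorProduct Finset

namespace HodgeRepro.Tier3

open HodgeRepro.RouteC

/-! ### The theorem: the Weil line is `∧^n_K V` — Deligne's direct summand on the abstract data -/

section WeilLine

variable {F₀ K : Type*} [Field F₀] [Field K] [Algebra F₀ K]
variable {V : Type*} [AddCommGroup V] [Module K V] [Module F₀ V] [IsScalarTower F₀ K V]
variable {ι : Type*} [Fintype ι] [DecidableEq ι] [DecidableEq (K ≃ₐ[F₀] K)]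
variable [FiniteDimensional F₀ K] [IsGalois F₀ K]

/-- **The Weil line is `∧^n_K V`** (LEMMA-R-RESIDUE.md §4(b); D1 Lemma 4.3(b) + Prop. 4.4's proof; M1 §2.2's
diagram — on the abstract data).  Data: `K/F₀` finite Galois, `V` with `K`-basis `ω′ : ι → V`, `n = |ι|`, an
eigenbasis `e′` of `K ⊗ V` (`(1 ⊗ b) e′(i, x) = x(b) • e′(i, x)` — `Tier3EigenBasis.exists_equivariant_eigenbasis`'s
second clause, or the constant-vector case `lTensor_lsmul_eigen_of_diag` of the diagonal relation exported by
`Tier3PullbackDictionary.exists_equivariant_eigenbasis_pullback`), the base change `Φ` of `Tier3WedgeBaseChange`, the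
wedge basis `E′_L = Φ⁻¹(e′_{L₁} ∧ ⋯ ∧ e′_{Lₙ})`, the Weil line `W_F ≤ ⋀[F₀]^n V` with
`W_F ⊗ K = span {E′_L : L a σ-line}` (the `W_F` of `Tier3LemmaRWeilLine.exists_rational_projector_wedge` on the lines,
which is how `Tier3LemmaRGenerator.exists_weil_line_generator` produces its Weil line), and the restriction-of-scalars
map `q` of `exists_restrictScalars_wedge`.  Conclusions: (1) `1 ⊗ q` kills every wedge `E′_L`
off the lines; (2) on the `σ`-line wedge it produces a `σ`-eigenvector (`(1 ⊗ b) ((1 ⊗ q) E′_{L_σ}) = σ(b) •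
(1 ⊗ q) E′_{L_σ}`); (3) the images of the line wedges form a `K`-basis of `K ⊗ ⋀[K]^n V` — «`W_F(B) ⊗ ℂ = ⊕_σ ⊗_i
ℓ^{(i)}_σ`» read through `q`; (4) `q` is injective on `W_F`; (5) `q` maps `W_F` ONTO `⋀[K]^n V`; (6)
`⋀[F₀]^n V = W_F ⊕ ker q` — Deligne's «`∧ⁿ_{k′} V` is, in a natural way, a direct summand of `∧ⁿ_k V`», with the
summand identified as the Weil line of the kernel twins. -/
theorem weil_line_restrictScalars [LinearOrder (ι × (K ≃ₐ[F₀] K))] [Nonempty ι]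
    (ω' : Module.Basis ι K V) {n : ℕ} (hn : Fintype.card ι = n)
    (e' : Module.Basis (ι × (K ≃ₐ[F₀] K)) K (K ⊗[F₀] V))
    (he2' : ∀ (x : K ≃ₐ[F₀] K) (i : ι) (b : K),
      LinearMap.lTensor K ((LinearMap.lsmul K V b).restrictScalars F₀) (e' (i, x)) = x b • e' (i, x))
    (Φ : K ⊗[F₀] ⋀[F₀]^n V ≃ₗ[K] ⋀[K]^n (K ⊗[F₀] V))
    (hΦ : ∀ (k : K) (v : Fin n → V),
      Φ (k ⊗ₜ[F₀] exteriorPower.ιMulti F₀ n v) = k • exteriorPower.ιMulti K n (fun i => (1 : K) ⊗ₜ[F₀] v i))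
    (E' : Module.Basis (Set.powersetCard (ι × (K ≃ₐ[F₀] K)) n) K (K ⊗[F₀] ⋀[F₀]^n V))
    (hE' : ∀ L, E' L = Φ.symm (exteriorPower.ιMulti_family K n e' L))
    (WF : Submodule F₀ (⋀[F₀]^n V))
    (hWF : WF.baseChange K =
      Submodule.span K (E' '' {L | ∃ σ : K ≃ₐ[F₀] K, (L : Finset (ι × (K ≃ₐ[F₀] K))) = lineSet σ}))
    (q : ⋀[F₀]^n V →ₗ[F₀] ⋀[K]^n V)
    (hq : ∀ v : Fin n → V, q (exteriorPower.ιMulti F₀ n v) = exteriorPower.ιMulti K n v) :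
    (∀ L : Set.powersetCard (ι × (K ≃ₐ[F₀] K)) n,
        (¬ ∃ σ : K ≃ₐ[F₀] K, (L : Finset (ι × (K ≃ₐ[F₀] K))) = lineSet σ) → q.baseChange K (E' L) = 0) ∧
    (∀ (L : Set.powersetCard (ι × (K ≃ₐ[F₀] K)) n) (σ : K ≃ₐ[F₀] K),
        (L : Finset (ι × (K ≃ₐ[F₀] K))) = lineSet σ → ∀ b : K,
        LinearMap.lTensor K ((LinearMap.lsmul K (⋀[K]^n V) b).restrictScalars F₀) (q.baseChange K (E' L)) =
          σ b • q.baseChange K (E' L)) ∧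
    (∀ U : (K ≃ₐ[F₀] K) → Set.powersetCard (ι × (K ≃ₐ[F₀] K)) n,
        (∀ σ, (U σ : Finset (ι × (K ≃ₐ[F₀] K))) = lineSet σ) →
        LinearIndependent K (fun σ => q.baseChange K (E' (U σ))) ∧
        Submodule.span K (Set.range fun σ => q.baseChange K (E' (U σ))) = ⊤) ∧
    (∀ v ∈ WF, q v = 0 → v = 0) ∧
    (∀ y : ⋀[K]^n V, ∃ v ∈ WF, q v = y) ∧
    IsCompl WF (LinearMap.ker q) := by
  classical
  have hn0 : 0 < n := hn ▸ Fintype.card_pos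
  -- the enumerated wedge
  have hE'L : ∀ L : Set.powersetCard (ι × (K ≃ₐ[F₀] K)) n,
      E' L = Φ.symm (exteriorPower.ιMulti K n (e' ∘ (Set.powersetCard.ofFinEmbEquiv.symm L))) :=
    fun L => hE' L
  have hw : ∀ (L : Set.powersetCard (ι × (K ≃ₐ[F₀] K)) n) (i : Fin n) (b : K),
      LinearMap.lTensor K ((LinearMap.lsmul K V b).restrictScalars F₀)
          ((e' ∘ (Set.powersetCard.ofFinEmbEquiv.symm L)) i) =
        ((Set.powersetCard.ofFinEmbEquiv.symm L) i).2 b • (e' ∘ (Set.powersetCard.ofFinEmbEquiv.symm L)) i :=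
    fun L i b => he2' _ _ b
  -- (1) off the lines
  have h1 : ∀ L : Set.powersetCard (ι × (K ≃ₐ[F₀] K)) n,
      (¬ ∃ σ : K ≃ₐ[F₀] K, (L : Finset (ι × (K ≃ₐ[F₀] K))) = lineSet σ) → q.baseChange K (E' L) = 0 := by
    intro L hL
    obtain ⟨j₁, j₂, hne⟩ := exists_snd_ne_of_not_lineSet hn hn0 L hL
    rw [hE'L]
    exact baseChange_restrictScalars_ιMulti_eq_zero_of_ne n q hq Φ hΦ _ _ (hw L) hne
  -- (2) on the lines
  have h2 : ∀ (L : Set.powersetCard (ι × (K ≃ₐ[F₀] K)) n) (σ : K ≃ₐ[F₀] K),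
      (L : Finset (ι × (K ≃ₐ[F₀] K))) = lineSet σ → ∀ b : K,
      LinearMap.lTensor K ((LinearMap.lsmul K (⋀[K]^n V) b).restrictScalars F₀) (q.baseChange K (E' L)) =
        σ b • q.baseChange K (E' L) := by
    intro L σ hL b
    rw [hE'L]
    refine baseChange_restrictScalars_ιMulti_smul_of_forall_eq hn0 q hq Φ hΦ _ σ ?_ b
    intro i c
    rw [hw L i c, snd_ofFinEmbEquiv_symm_eq_of_lineSet L σ hL i]
  -- dimensions
  haveI : Module.Finite K V := Module.Finite.of_basis ω'
  have hdimV : Module.finrank K V = n := by rw [Module.finrank_eq_card_basis ω', hn]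
  have hdimK : Module.finrank K (⋀[K]^n V) = 1 := by
    rw [exteriorPower.finrank_eq K n, hdimV, Nat.choose_self]
  have hcardGal : Fintype.card (K ≃ₐ[F₀] K) = Module.finrank F₀ K := by
    rw [← Nat.card_eq_fintype_card, IsGalois.card_aut_eq_finrank]
  have hXdim : Module.finrank F₀ (⋀[K]^n V) = Fintype.card (K ≃ₐ[F₀] K) := by
    rw [← Module.finrank_mul_finrank F₀ K (⋀[K]^n V), hdimK, mul_one, hcardGal]
  have hTdim : Module.finrank K (K ⊗[F₀] ⋀[K]^n V) = Fintype.card (K ≃ₐ[F₀] K) := by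
    rw [Module.finrank_baseChange, hXdim]
  -- surjectivity of `1 ⊗ q`
  have hqsurj : Function.Surjective (q.baseChange K) :=
    LinearMap.baseChange_surjective K (surjective_of_ιMulti_eq hn0 q hq)
  -- (3) the line images form a basis
  have h3 : ∀ U : (K ≃ₐ[F₀] K) → Set.powersetCard (ι × (K ≃ₐ[F₀] K)) n,
      (∀ σ, (U σ : Finset (ι × (K ≃ₐ[F₀] K))) = lineSet σ) →
      LinearIndependent K (fun σ => q.baseChange K (E' (U σ))) ∧
      Submodule.span K (Set.range fun σ => q.baseChange K (E' (U σ))) = ⊤ := by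
    intro U hU
    have hspan : Submodule.span K (Set.range fun σ => q.baseChange K (E' (U σ))) = ⊤ := by
      rw [eq_top_iff]
      intro y _
      obtain ⟨z, rfl⟩ := hqsurj y
      rw [← E'.sum_repr z, map_sum]
      refine Submodule.sum_mem _ fun L _ => ?_
      rw [map_smul]
      by_cases hL : ∃ σ : K ≃ₐ[F₀] K, (L : Finset (ι × (K ≃ₐ[F₀] K))) = lineSet σ
      · obtain ⟨σ, hσ⟩ := hL
        have hLU : L = U σ := Subtype.ext (hσ.trans (hU σ).symm)
        rw [hLU]
        exact Submodule.smul_mem _ _ (Submodule.subset_span ⟨σ, rfl⟩)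
      · rw [h1 L hL, smul_zero]
        exact Submodule.zero_mem _
    exact ⟨linearIndependent_of_top_le_span_of_card_eq_finrank hspan.ge hTdim.symm, hspan⟩
  -- the lines as `n`-subsets
  have hcardL : ∀ σ : K ≃ₐ[F₀] K, (lineSet (ι := ι) σ).card = n := by
    intro σ
    rw [card_lineSet, hn]
  obtain ⟨U, hU⟩ : ∃ U : (K ≃ₐ[F₀] K) → Set.powersetCard (ι × (K ≃ₐ[F₀] K)) n,
      ∀ σ, (U σ : Finset (ι × (K ≃ₐ[F₀] K))) = lineSet σ :=
    ⟨fun σ => ⟨lineSet σ, Set.powersetCard.mem_iff.mpr (hcardL σ)⟩, fun σ => rfl⟩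
  have hUinj : Function.Injective U := by
    intro σ τ h
    obtain ⟨i⟩ := ‹Nonempty ι›
    have h1' : (i, σ) ∈ (U τ : Finset (ι × (K ≃ₐ[F₀] K))) := by
      rw [← h, hU σ, mem_lineSet]
    rw [hU τ, mem_lineSet] at h1'
    exact h1'
  have hset : {L : Set.powersetCard (ι × (K ≃ₐ[F₀] K)) n |
      ∃ σ : K ≃ₐ[F₀] K, (L : Finset (ι × (K ≃ₐ[F₀] K))) = lineSet σ} = Set.range U := by
    ext L
    constructor
    · rintro ⟨σ, hσ⟩
      exact ⟨σ, Subtype.ext ((hU σ).trans hσ.symm)⟩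
    · rintro ⟨σ, rfl⟩
      exact ⟨σ, hU σ⟩
  have hWF' : WF.baseChange K = Submodule.span K (Set.range fun σ => E' (U σ)) := by
    rw [hWF, hset, ← Set.range_comp]
    rfl
  obtain ⟨hli, -⟩ := h3 U hU
  -- (4) injective on `W_F`
  have h4 : ∀ v ∈ WF, q v = 0 → v = 0 := by
    intro v hv hqv
    have hmem : (1 : K) ⊗ₜ[F₀] v ∈ WF.baseChange K := Submodule.tmul_mem_baseChange_of_mem 1 hv
    rw [hWF', Submodule.mem_span_range_iff_exists_fun] at hmem
    obtain ⟨c, hc⟩ := hmem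
    have hzero : ∑ σ, c σ • q.baseChange K (E' (U σ)) = 0 := by
      have := congrArg (q.baseChange K) hc
      rw [map_sum, LinearMap.baseChange_tmul, hqv, TensorProduct.tmul_zero] at this
      simpa only [map_smul] using this
    have hc0 : ∀ σ, c σ = 0 := Fintype.linearIndependent_iff.mp hli c hzero
    have h10 : (1 : K) ⊗ₜ[F₀] v = 0 := by
      rw [← hc]
      exact Finset.sum_eq_zero fun σ _ => by rw [hc0 σ, zero_smul]
    exact (tmul_one_eq_zero_iff (F₀ := F₀) (K := K) v).mp h10
  -- (5) onto: `dim_{F₀} W_F = |Gal| = dim_{F₀} ⋀[K]^n V`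
  have hWdim : Module.finrank F₀ WF = Fintype.card (K ≃ₐ[F₀] K) := by
    have hcoe : (↑(Finset.univ.image U) : Set (Set.powersetCard (ι × (K ≃ₐ[F₀] K)) n)) = Set.range U := by
      rw [Finset.coe_image, Finset.coe_univ, Set.image_univ]
    rw [finrank_eq_card_of_baseChange_eq_span E' (Finset.univ.image U) WF (by
      rw [hWF', hcoe, ← Set.range_comp]; rfl), Finset.card_image_of_injective _ hUinj, Finset.card_univ]
  haveI : Module.Finite F₀ V := Module.Finite.trans K V
  haveI : FiniteDimensional F₀ (⋀[K]^n V) := Module.Finite.trans K (⋀[K]^n V)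
  have hinj : Function.Injective (q.domRestrict WF) := by
    intro x y hxy
    apply Subtype.ext
    have hsub : q (x.1 - y.1) = 0 := by
      rw [map_sub, sub_eq_zero]
      exact hxy
    exact sub_eq_zero.mp (h4 _ (Submodule.sub_mem _ x.2 y.2) hsub)
  have hsurj : Function.Surjective (q.domRestrict WF) := by
    have hfd : FiniteDimensional F₀ WF := inferInstance
    have hiff := @LinearMap.injective_iff_surjective_of_finrank_eq_finrank F₀ WF _ _ _ (⋀[K]^n V) _ _
      hfd _ (hWdim.trans hXdim.symm) (q.domRestrict WF)
    exact hiff.mp hinj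
  have h5 : ∀ y : ⋀[K]^n V, ∃ v ∈ WF, q v = y := by
    intro y
    obtain ⟨x, hx⟩ := hsurj y
    exact ⟨x.1, x.2, hx⟩
  -- (6) the direct sum
  have h6 : IsCompl WF (LinearMap.ker q) := by
    refine ⟨Submodule.disjoint_def.mpr fun v hv hk => h4 v hv (LinearMap.mem_ker.mp hk), ?_⟩
    rw [Submodule.codisjoint_iff_exists_add_eq]
    intro z
    obtain ⟨w, hw, hqw⟩ := h5 (q z)
    refine ⟨w, z - w, hw, ?_, add_sub_cancel w z⟩
    rw [LinearMap.mem_ker, map_sub, hqw, sub_self]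
  exact ⟨h1, h2, h3, h4, h5, h6⟩

/-- **Deligne's section.**  Under the hypotheses of `weil_line_restrictScalars`, the restriction-of-scalars map
`q : ⋀[F₀]^n V → ⋀[K]^n V` has an `F₀`-linear section `s` whose image is exactly the Weil line `W_F`:
`q ∘ s = id`, `s y ∈ W_F`, and `s (q w) = w` for `w ∈ W_F` — «`∧ⁿ_{k′} V` is, in a natural way, a direct summand
of `∧ⁿ_k V`» (D1 Lemma 4.3(b)) with the summand `s(⋀[K]^n V) = W_F`.  (`s` is the inverse of the bijection
`q|_{W_F}`, so it is determined by `W_F`, which is itself determined by its base change.) -/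
theorem exists_weil_line_section [LinearOrder (ι × (K ≃ₐ[F₀] K))] [Nonempty ι]
    (ω' : Module.Basis ι K V) {n : ℕ} (hn : Fintype.card ι = n)
    (e' : Module.Basis (ι × (K ≃ₐ[F₀] K)) K (K ⊗[F₀] V))
    (he2' : ∀ (x : K ≃ₐ[F₀] K) (i : ι) (b : K),
      LinearMap.lTensor K ((LinearMap.lsmul K V b).restrictScalars F₀) (e' (i, x)) = x b • e' (i, x))
    (Φ : K ⊗[F₀] ⋀[F₀]^n V ≃ₗ[K] ⋀[K]^n (K ⊗[F₀] V))
    (hΦ : ∀ (k : K) (v : Fin n → V),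
      Φ (k ⊗ₜ[F₀] exteriorPower.ιMulti F₀ n v) = k • exteriorPower.ιMulti K n (fun i => (1 : K) ⊗ₜ[F₀] v i))
    (E' : Module.Basis (Set.powersetCard (ι × (K ≃ₐ[F₀] K)) n) K (K ⊗[F₀] ⋀[F₀]^n V))
    (hE' : ∀ L, E' L = Φ.symm (exteriorPower.ιMulti_family K n e' L))
    (WF : Submodule F₀ (⋀[F₀]^n V))
    (hWF : WF.baseChange K =
      Submodule.span K (E' '' {L | ∃ σ : K ≃ₐ[F₀] K, (L : Finset (ι × (K ≃ₐ[F₀] K))) = lineSet σ}))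
    (q : ⋀[F₀]^n V →ₗ[F₀] ⋀[K]^n V)
    (hq : ∀ v : Fin n → V, q (exteriorPower.ιMulti F₀ n v) = exteriorPower.ιMulti K n v) :
    ∃ s : ⋀[K]^n V →ₗ[F₀] ⋀[F₀]^n V,
      (∀ y, q (s y) = y) ∧ (∀ y, s y ∈ WF) ∧ (∀ w ∈ WF, s (q w) = w) := by
  obtain ⟨-, -, -, h4, h5, -⟩ :=
    weil_line_restrictScalars ω' hn e' he2' Φ hΦ E' hE' WF hWF q hq
  have hinj : Function.Injective (q.domRestrict WF) := by
    intro x y hxy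
    apply Subtype.ext
    have hsub : q (x.1 - y.1) = 0 := by
      rw [map_sub, sub_eq_zero]
      exact hxy
    exact sub_eq_zero.mp (h4 _ (Submodule.sub_mem _ x.2 y.2) hsub)
  have hsurj : Function.Surjective (q.domRestrict WF) := by
    intro y
    obtain ⟨v, hv, hqv⟩ := h5 y
    exact ⟨⟨v, hv⟩, hqv⟩
  let e : WF ≃ₗ[F₀] ⋀[K]^n V := LinearEquiv.ofBijective (q.domRestrict WF) ⟨hinj, hsurj⟩
  refine ⟨WF.subtype ∘ₗ e.symm.toLinearMap, fun y => ?_, fun y => ?_, fun w hw => ?_⟩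
  · have h : q (e.symm y).1 = e (e.symm y) := rfl
    rw [LinearMap.comp_apply, LinearEquiv.coe_coe, Submodule.subtype_apply, h, e.apply_symm_apply]
  · exact (e.symm y).2
  · have h : e ⟨w, hw⟩ = q w := rfl
    simp only [LinearMap.comp_apply, LinearEquiv.coe_coe, Submodule.subtype_apply]
    rw [← h, e.symm_apply_apply]

/-- **Everything assembled as one existential** (the lane's style): from `ω′ : ι → V` alone — with the left-multiplication
action of `Gal(K/F₀)` on `ι × Gal` — there are the eigenbasis `e′` (`Tier3EigenBasis`), the base change `Φ`
(`Tier3WedgeBaseChange`), the wedge basis `E′`, the Weil line `W_F` with its rational projector `e₀`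
(`Tier3LemmaRWeilLine.exists_rational_projector_wedge` on the lines; `dim_{F₀} W_F = [K : F₀]`) and the
restriction-of-scalars map `q`, such that `q` is onto `⋀[K]^n V`, injective on `W_F`, maps `W_F` onto `⋀[K]^n V`,
`⋀[F₀]^n V = W_F ⊕ ker q`, and a section `s` of `q` has image `W_F` — the hypotheses of `weil_line_restrictScalars`
are simultaneously satisfiable, and the `W_F` so produced is the one every Lemma-R twin of the lane works with. -/
theorem exists_weil_line_restrictScalars [LinearOrder (ι × (K ≃ₐ[F₀] K))] [Nonempty ι]
    [MulAction (K ≃ₐ[F₀] K) (ι × (K ≃ₐ[F₀] K))]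
    (hact' : ∀ (σ x : K ≃ₐ[F₀] K) (i : ι), σ • (i, x) = (i, σ * x))
    (ω' : Module.Basis ι K V) {n : ℕ} (hn : Fintype.card ι = n) :
    ∃ (e' : Module.Basis (ι × (K ≃ₐ[F₀] K)) K (K ⊗[F₀] V))
      (Φ : K ⊗[F₀] ⋀[F₀]^n V ≃ₗ[K] ⋀[K]^n (K ⊗[F₀] V))
      (E' : Module.Basis (Set.powersetCard (ι × (K ≃ₐ[F₀] K)) n) K (K ⊗[F₀] ⋀[F₀]^n V))
      (WF : Submodule F₀ (⋀[F₀]^n V)) (e₀ : ⋀[F₀]^n V →ₗ[F₀] ⋀[F₀]^n V)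
      (q : ⋀[F₀]^n V →ₗ[F₀] ⋀[K]^n V),
      (∀ (σ x : K ≃ₐ[F₀] K) (i : ι), LinearMap.rTensor V σ.toLinearMap (e' (i, x)) = e' (i, σ * x)) ∧
      (∀ (x : K ≃ₐ[F₀] K) (i : ι) (b : K),
        LinearMap.lTensor K ((LinearMap.lsmul K V b).restrictScalars F₀) (e' (i, x)) = x b • e' (i, x)) ∧
      (∀ (k : K) (v : Fin n → V),
        Φ (k ⊗ₜ[F₀] exteriorPower.ιMulti F₀ n v) = k • exteriorPower.ιMulti K n (fun i => (1 : K) ⊗ₜ[F₀] v i)) ∧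
      (∀ L, E' L = Φ.symm (exteriorPower.ιMulti_family K n e' L)) ∧
      WF.baseChange K =
        Submodule.span K (E' '' {L | ∃ σ : K ≃ₐ[F₀] K, (L : Finset (ι × (K ≃ₐ[F₀] K))) = lineSet σ}) ∧
      (∀ v, e₀ v ∈ WF) ∧ (∀ w ∈ WF, e₀ w = w) ∧ Module.finrank F₀ WF = Module.finrank F₀ K ∧
      (∀ v : Fin n → V, q (exteriorPower.ιMulti F₀ n v) = exteriorPower.ιMulti K n v) ∧
      Function.Surjective q ∧
      (∀ v ∈ WF, q v = 0 → v = 0) ∧ (∀ y : ⋀[K]^n V, ∃ v ∈ WF, q v = y) ∧ IsCompl WF (LinearMap.ker q) ∧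
      ∃ s : ⋀[K]^n V →ₗ[F₀] ⋀[F₀]^n V, (∀ y, q (s y) = y) ∧ (∀ y, s y ∈ WF) ∧ (∀ w ∈ WF, s (q w) = w) := by
  classical
  have hn0 : 0 < n := hn ▸ Fintype.card_pos
  -- the eigenbasis, the base change, the wedge basis
  obtain ⟨e', he1', he2'⟩ := exists_equivariant_eigenbasis (F₀ := F₀) ω'
  obtain ⟨Φ, hΦ⟩ := exists_wedgeBaseChange (F₀ := F₀) (K := K) (V := V) n
  obtain ⟨E', hE'def⟩ : ∃ E' : Module.Basis (Set.powersetCard (ι × (K ≃ₐ[F₀] K)) n) K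
      (K ⊗[F₀] ⋀[F₀]^n V), E' = (e'.exteriorPower n).map Φ.symm := ⟨_, rfl⟩
  have hE' : ∀ L, E' L = Φ.symm (exteriorPower.ιMulti_family K n e' L) := by
    intro L
    rw [hE'def, Module.Basis.map_apply, exteriorPower.basis_apply]
  -- the lines as `n`-subsets
  have hcardL : ∀ σ : K ≃ₐ[F₀] K, (lineSet (ι := ι) σ).card = n := by
    intro σ
    rw [card_lineSet, hn]
  obtain ⟨U, hU⟩ : ∃ U : (K ≃ₐ[F₀] K) → Set.powersetCard (ι × (K ≃ₐ[F₀] K)) n,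
      ∀ σ, (U σ : Finset (ι × (K ≃ₐ[F₀] K))) = lineSet σ :=
    ⟨fun σ => ⟨lineSet σ, Set.powersetCard.mem_iff.mpr (hcardL σ)⟩, fun σ => rfl⟩
  have hmemU : ∀ (σ : K ≃ₐ[F₀] K) (p : ι × (K ≃ₐ[F₀] K)), p ∈ U σ ↔ p.2 = σ := by
    intro σ p
    rw [← Set.powersetCard.mem_coe_iff, hU σ, mem_lineSet]
  set P : Finset (Set.powersetCard (ι × (K ≃ₐ[F₀] K)) n) := Finset.univ.image U with hPdef
  have hmemP : ∀ L : Set.powersetCard (ι × (K ≃ₐ[F₀] K)) n,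
      L ∈ P ↔ ∃ σ : K ≃ₐ[F₀] K, (L : Finset (ι × (K ≃ₐ[F₀] K))) = lineSet σ := by
    intro L
    rw [hPdef, Finset.mem_image]
    constructor
    · rintro ⟨σ, -, rfl⟩
      exact ⟨σ, hU σ⟩
    · rintro ⟨σ, hσ⟩
      exact ⟨σ, Finset.mem_univ _, Subtype.ext ((hU σ).trans hσ.symm)⟩
  -- Galois stability of the lines (membership level): `σ • L_τ = L_{στ}`
  have hequiv : ∀ (σ : K ≃ₐ[F₀] K) (i : ι × (K ≃ₐ[F₀] K)),
      LinearMap.rTensor V σ.toLinearMap (e' i) = e' (σ • i) := by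
    intro σ i
    rw [hact' σ i.2 i.1]
    exact he1' σ i.2 i.1
  have hP : ∀ (σ : K ≃ₐ[F₀] K), ∀ s ∈ P, ∃ s' ∈ P, ∀ p : ι × (K ≃ₐ[F₀] K), p ∈ s' ↔ ∃ q ∈ s, σ • q = p := by
    intro σ s hs
    obtain ⟨τ, hτ⟩ := (hmemP s).mp hs
    refine ⟨U (σ * τ), (hmemP _).mpr ⟨σ * τ, hU _⟩, fun p => ?_⟩
    rw [hmemU]
    constructor
    · intro hp
      refine ⟨(p.1, τ), ?_, ?_⟩
      · rw [← Set.powersetCard.mem_coe_iff, hτ, mem_lineSet]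
      · rw [hact', ← hp]
    · rintro ⟨q, hq, rfl⟩
      rw [← Set.powersetCard.mem_coe_iff, hτ, mem_lineSet] at hq
      rw [← Prod.mk.eta (p := q), hact', hq]
  -- the Weil line and its rational projector
  obtain ⟨WF, e₀, hWF, he₀mem, he₀id, -⟩ := exists_rational_projector_wedge n e' hequiv Φ hΦ P hP
  rw [← hE'def] at hWF
  have hWF' : WF.baseChange K =
      Submodule.span K (E' '' {L | ∃ σ : K ≃ₐ[F₀] K, (L : Finset (ι × (K ≃ₐ[F₀] K))) = lineSet σ}) := by
    rw [hWF]
    congr 2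
    ext L
    exact hmemP L
  have hUinj : Function.Injective U := by
    intro σ τ h
    obtain ⟨i⟩ := ‹Nonempty ι›
    have h1 : (i, σ) ∈ U τ := by rw [← h, hmemU]
    rw [hmemU] at h1
    exact h1
  have hWdim : Module.finrank F₀ WF = Module.finrank F₀ K := by
    rw [finrank_eq_card_of_baseChange_eq_span E' P WF hWF, hPdef, Finset.card_image_of_injective _ hUinj,
      Finset.card_univ, ← Nat.card_eq_fintype_card, IsGalois.card_aut_eq_finrank]
  -- the restriction-of-scalars map and the theorem
  obtain ⟨q, hq⟩ := exists_restrictScalars_wedge (F₀ := F₀) (K := K) (V := V) n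
  obtain ⟨-, -, -, h4, h5, h6⟩ := weil_line_restrictScalars ω' hn e' he2' Φ hΦ E' hE' WF hWF' q hq
  obtain ⟨s, hs⟩ := exists_weil_line_section ω' hn e' he2' Φ hΦ E' hE' WF hWF' q hq
  exact ⟨e', Φ, E', WF, e₀, q, he1', he2', hΦ, hE', hWF', he₀mem, he₀id, hWdim, hq,
    surjective_of_ιMulti_eq hn0 q hq, h4, h5, h6, s, hs⟩

end WeilLine

end HodgeRepro.Tier3
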